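import Summits.CriticalPhenomena.PercolationContinuityZ3.Theorems.PercNearOneGluingNoHeavyLowerTailThreePartitionOneOrHeart
import Summits.CriticalPhenomena.PercolationContinuityZ3.Theorems.PercNearOneGluingNoHeavyLowerTailThreePartitionGridOrOr
import HarnessLib.Audit

/-!
# `NoHeavyLowerTail` (crux stmt-CriticalPhenomena-4575), master-family hierarchy P3 (gen 37): the ONE-DISJUNCTION THEOREM, untwisted-`Q` case —
# `threePartNT τ (orFam Q) A B ≥ 0` for ALL up-sets `A, B` and every twist `τ` disjoint from `Q`

Support file (seat `prim-masterthm-p3`; `--supports stmt-CriticalPhenomena-4575`; memo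
`run/shared/lean/prim/prim-masterthm/FROM-prim-masterthm-p3-g37-ONE-DISJUNCTION.md` §2, §4).  Assembles `…ThreePartitionOneOrPatterns` (product
decomposition `triT_eq_sum_cfgsIn`, `threePartNT = Φ − R`), `…OneOrBase` / `…OneOrHeart` (the weights `W`, `K*`, `φ`, `μ ≥ 0` and the two
pointwise inequalities (♥) `W ≤ K*`, (b) `K* ≤ φ`) and the tree's Kleitman step `teeT_le_deeT`.
THE CHAIN (τ ∩ Q = ∅).  With the representatives `𝒰rep = {x : x ∩ Q = Q \ τ}` of the traces off `Q` and the shifted up-sets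
`shiftQ Q A m = {x : (x \ Q) ∪ m ∈ A}`:
  `R = Σ_P c(P)·tee_P = Σ_x W(𝔄_x, 𝔅_x) ≤ Σ_x K*(𝔄_x, 𝔅_x) = Σ_{a≠∅} μ(a)·teeT τ 𝒰rep (shiftQ A a) (shiftQ B a)`      [(♥) pointwise]
  `  ≤ Σ_{a≠∅} μ(a)·deeT τ 𝒰rep (shiftQ A a ∩ shiftQ B a) = Σ_x K*(𝔇_x,𝔇_x) ≤ Σ_x φ(𝔇_x) = Φ`                       [Kleitman, μ ≥ 0; (b) pointwise]
where `𝔄_x = {m : (x₂\Q) ∪ m ∈ A}`, `𝔅_x = {m : (x₃\Q) ∪ m ∈ B}`, `𝔇_x = {m : (x₃\Q) ∪ m ∈ A ∩ B}` are the signatures (up-sets of `2^Q`) of the traces.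
Main result here: `threePartNT_orFam_nonneg_of_disjoint`.  The case `τ ∩ Q ≠ ∅` and the corollaries are in `…ThreePartitionOneOrTwisted`.
HONEST LABEL: COMB-C3 for one disjunction against two ARBITRARY increasing events (untwisted-`Q` profiles); the general conjecture stays OPEN;
nothing bears on the (closed) crux. [this work]
-/

noncomputable section

open Finset
open scoped symmDiff Classical

namespace Summit.CriticalPhenomena.PercolationContinuityZ3.Theorems.ThreePartition

variable {ι : Type*} [Fintype ι]

/-! ## Representatives, shifted families, and twisted counts as sums of indicators -/

omit [Fintype ι] in
/-- The representatives of the traces off `Q`: configurations whose copy 1 meets `Q` in `Q \ τ` (i.e. `Q` parked in part 1). [this work] -/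
def repU (τ Q : Set ι) : Set (Set ι) := {x | x ∩ Q = Q \ τ}

omit [Fintype ι] in
/-- The SHIFTED FAMILY `{x : (x \ Q) ∪ m ∈ A}` — membership of the trace `x \ Q` glued with the Q-part `m`. [this work] -/
def shiftQ (Q : Set ι) (A : Set (Set ι)) (m : Set ι) : Set (Set ι) := {x | x \ Q ∪ m ∈ A}

omit [Fintype ι] in
/-- Membership in `shiftQ`. [this work] -/
@[simp] theorem mem_shiftQ {Q : Set ι} {A : Set (Set ι)} {m x : Set ι} : x ∈ shiftQ Q A m ↔ x \ Q ∪ m ∈ A := Iff.rfl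

omit [Fintype ι] in
/-- A shifted up-set is an up-set. [this work] -/
theorem isUpperSet_shiftQ (Q : Set ι) {A : Set (Set ι)} (hA : IsUpperSet A) (m : Set ι) : IsUpperSet (shiftQ Q A m) :=
  fun _ _ hxy hx => hA (Set.union_subset_union_left _ (Set.sdiff_subset_sdiff_left hxy)) hx

omit [Fintype ι] in
/-- The signature of a trace `y`: `{m : y ∪ m ∈ A}` is an up-set. [this work] -/
theorem isUpperSet_sig {A : Set (Set ι)} (hA : IsUpperSet A) (y : Set ι) : IsUpperSet {m : Set ι | y ∪ m ∈ A} :=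
  fun _ _ hmm hm => hA (Set.union_subset_union_right _ hmm) hm

/-- The weight of a configuration `q = (S₁,S₂)` among the representatives: `[S₁ ∩ S₂ = ∅]·[x₁ ∩ Q = Q \ τ]`. [this work] -/
def repInd (τ Q : Set ι) (q : Set ι × Set ι) : ℤ := indZ (Disjoint q.1 q.2 ∧ (q.1 ∆ τ) ∩ Q = Q \ τ)

omit [Fintype ι] in
/-- `repInd ≥ 0`. [this work] -/
theorem repInd_nonneg (τ Q : Set ι) (q : Set ι × Set ι) : 0 ≤ repInd τ Q q := indZ_nonneg _

/-- **A representative count as a weighted sum over all pairs** `(S₁,S₂)`: the predicate on copies 2 and 3 becomes an indicator. [this work] -/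
theorem triT_rep_eq_sum (τ Q : Set ι) (R : Set ι → Set ι → Prop) :
    (triT τ (fun x₁ x₂ x₃ => x₁ ∩ Q = Q \ τ ∧ R x₂ x₃) : ℤ) =
      ∑ q : Set ι × Set ι, repInd τ Q q * indZ (R (q.2 ∆ τ) ((q.1 ∪ q.2)ᶜ ∆ τ)) := by
  unfold triT tri repInd
  rw [card_filter_eq_sum_indZ]
  refine sum_congr rfl fun q _ => ?_
  rw [← indZ_and]
  exact indZ_congr ⟨fun h => ⟨⟨h.1, h.2.1⟩, h.2.2⟩, fun h => ⟨h.1.1, h.1.2, h.2⟩⟩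

/-- A twisted count as a sum of indicators over all pairs `(S₁,S₂)`. [this work] -/
theorem triT_eq_sum_indZ (τ : Set ι) (p : Set ι → Set ι → Set ι → Prop) :
    (triT τ p : ℤ) = ∑ q : Set ι × Set ι, indZ (Disjoint q.1 q.2 ∧ p (q.1 ∆ τ) (q.2 ∆ τ) ((q.1 ∪ q.2)ᶜ ∆ τ)) := by
  unfold triT tri; rw [card_filter_eq_sum_indZ]

/-- A twisted count with a CONSTANT extra condition. [this work] -/
theorem triT_and_const (τ : Set ι) (p : Set ι → Set ι → Set ι → Prop) (c : Prop) :
    (triT τ (fun x₁ x₂ x₃ => p x₁ x₂ x₃ ∧ c) : ℤ) = indZ c * triT τ p := by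
  rw [triT_eq_sum_indZ, triT_eq_sum_indZ, mul_sum]
  refine sum_congr rfl fun q _ => ?_
  rw [← indZ_and]
  exact indZ_congr ⟨fun h => ⟨h.2.2, h.1, h.2.1⟩, fun h => ⟨h.2.1, h.2.2, h.1⟩⟩

omit [Fintype ι] in
/-- Gluing a Q-part `m ⊆ Q` onto a trace and intersecting with `Q` gives back `m`. [this work] -/
theorem sdiff_union_inter_eq {Q x m : Set ι} (hm : m ⊆ Q) : (x \ Q ∪ m) ∩ Q = m := by
  ext c; simp only [Set.mem_inter_iff, Set.mem_union, Set.mem_sdiff]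
  constructor
  · rintro ⟨h | h, hQ⟩; exacts [absurd hQ h.2, h]
  · intro h; exact ⟨Or.inr h, hm h⟩

omit [Fintype ι] in
/-- Hence `(x \ Q) ∪ m ∈ orFam Q ↔ m ≠ ∅` for `m ⊆ Q`. [this work] -/
theorem sdiff_union_mem_orFam_iff {Q x m : Set ι} (hm : m ⊆ Q) : x \ Q ∪ m ∈ orFam Q ↔ m.Nonempty := by
  rw [mem_orFam, sdiff_union_inter_eq hm]

/-! ## Step 1: the two-copy part as a pattern sum of representative counts -/

section Chain

variable (τ Q : Set ι) (A B : Set (Set ι))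

/-- The representative `tee`-count with Q-parts `m₂` on copy 2 (tested against `A`) and `m₃` on copy 3 (against `B`). [this work] -/
def teeRep (m₂ m₃ : Set ι) : ℤ := triT τ (fun x₁ x₂ x₃ => x₁ ∩ Q = Q \ τ ∧ (x₂ \ Q ∪ m₂ ∈ A ∧ x₃ \ Q ∪ m₃ ∈ B))

/-- The pattern weight `c(P) = [qc₂ ≠ ∅] + [qc₃ ≠ ∅] − [qc₁ ≠ ∅]`. [this work] -/
def cPat (P : Set ι × Set ι) : ℤ := indZ (qc₂ τ Q P).Nonempty + indZ (qc₃ τ Q P).Nonempty - indZ (qc₁ τ Q P).Nonempty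

/-- **`R = Σ_P c(P)·teeRep(qc₂ P, qc₃ P)`** (any twist). [this work] -/
theorem rPart_eq_sum_cPat :
    rPart τ (orFam Q) A B = ∑ P ∈ cfgsIn Q, cPat τ Q P * teeRep τ Q A B (qc₂ τ Q P) (qc₃ τ Q P) := by
  unfold rPart cPat teeRep
  rw [triT_eq_sum_cfgsIn τ Q (fun _ x₂ x₃ => x₂ ∈ A ∧ x₃ ∈ B ∧ x₃ ∈ orFam Q),
    triT_eq_sum_cfgsIn τ Q (fun _ x₂ x₃ => x₂ ∈ A ∧ x₃ ∈ B ∧ x₂ ∈ orFam Q),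
    triT_eq_sum_cfgsIn τ Q (fun x₁ x₂ x₃ => x₂ ∈ A ∧ x₃ ∈ B ∧ x₁ ∈ orFam Q)]
  push_cast
  rw [← sum_add_distrib, ← sum_sub_distrib]
  refine sum_congr rfl fun P hP => ?_
  rw [mem_cfgsIn] at hP
  have e1 : (triT τ (fun x₁ x₂ x₃ => x₁ ∩ Q = Q \ τ ∧ (x₂ \ Q ∪ qc₂ τ Q P ∈ A ∧ x₃ \ Q ∪ qc₃ τ Q P ∈ B ∧ x₃ \ Q ∪ qc₃ τ Q P ∈ orFam Q)) : ℤ)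
      = indZ (qc₃ τ Q P).Nonempty * triT τ (fun x₁ x₂ x₃ => x₁ ∩ Q = Q \ τ ∧ (x₂ \ Q ∪ qc₂ τ Q P ∈ A ∧ x₃ \ Q ∪ qc₃ τ Q P ∈ B)) := by
    rw [← triT_and_const]; exact_mod_cast triT_congr fun a b d => by
      rw [sdiff_union_mem_orFam_iff (x := d) (qc₃_subset τ Q P)]; tauto
  have e2 : (triT τ (fun x₁ x₂ x₃ => x₁ ∩ Q = Q \ τ ∧ (x₂ \ Q ∪ qc₂ τ Q P ∈ A ∧ x₃ \ Q ∪ qc₃ τ Q P ∈ B ∧ x₂ \ Q ∪ qc₂ τ Q P ∈ orFam Q)) : ℤ)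
      = indZ (qc₂ τ Q P).Nonempty * triT τ (fun x₁ x₂ x₃ => x₁ ∩ Q = Q \ τ ∧ (x₂ \ Q ∪ qc₂ τ Q P ∈ A ∧ x₃ \ Q ∪ qc₃ τ Q P ∈ B)) := by
    rw [← triT_and_const]; exact_mod_cast triT_congr fun a b d => by
      rw [sdiff_union_mem_orFam_iff (x := b) (qc₂_subset (τ := τ) hP.2.1)]; tauto
  have e3 : (triT τ (fun x₁ x₂ x₃ => x₁ ∩ Q = Q \ τ ∧ (x₂ \ Q ∪ qc₂ τ Q P ∈ A ∧ x₃ \ Q ∪ qc₃ τ Q P ∈ B ∧ x₁ \ Q ∪ qc₁ τ Q P ∈ orFam Q)) : ℤ)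
      = indZ (qc₁ τ Q P).Nonempty * triT τ (fun x₁ x₂ x₃ => x₁ ∩ Q = Q \ τ ∧ (x₂ \ Q ∪ qc₂ τ Q P ∈ A ∧ x₃ \ Q ∪ qc₃ τ Q P ∈ B)) := by
    rw [← triT_and_const]; exact_mod_cast triT_congr fun a b d => by
      rw [sdiff_union_mem_orFam_iff (x := a) (qc₁_subset (τ := τ) hP.1)]; tauto
  rw [e1, e2, e3]; ring

end Chain

/-! ## Step 2: the chain in the untwisted-`Q` case -/

section Untwisted

variable {τ Q : Set ι} (hτ : τ ∩ Q = ∅) (A B : Set (Set ι))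
include hτ

omit [Fintype ι] in
/-- With `τ ∩ Q = ∅` the twisted Q-parts are the parts. [this work] -/
theorem qc₁_eq (P : Set ι × Set ι) : qc₁ τ Q P = P.1 := by unfold qc₁; rw [hτ]; exact symmDiff_bot _
omit [Fintype ι] in
/-- With `τ ∩ Q = ∅` the twisted Q-parts are the parts. [this work] -/
theorem qc₂_eq (P : Set ι × Set ι) : qc₂ τ Q P = P.2 := by unfold qc₂; rw [hτ]; exact symmDiff_bot _
omit [Fintype ι] in
/-- With `τ ∩ Q = ∅` the twisted Q-parts are the parts. [this work] -/
theorem qc₃_eq (P : Set ι × Set ι) : qc₃ τ Q P = pt₃ Q P := by unfold qc₃; rw [hτ]; exact symmDiff_bot _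

end Untwisted

section ChainII

variable (τ Q : Set ι) (A B : Set (Set ι))

/-- Trace of copy 2 off `Q`, for a pair `q = (S₁,S₂)`. [this work] -/
def tr₂ (q : Set ι × Set ι) : Set ι := (q.2 ∆ τ) \ Q
/-- Trace of copy 3 off `Q`. [this work] -/
def tr₃ (q : Set ι × Set ι) : Set ι := ((q.1 ∪ q.2)ᶜ ∆ τ) \ Q

/-- The representative `dee`-count with Q-part `m` on copy 3, tested against `A ∩ B`. [this work] -/
def deeRep (m : Set ι) : ℤ := triT τ (fun x₁ _ x₃ => x₁ ∩ Q = Q \ τ ∧ (x₃ \ Q ∪ m ∈ A ∧ x₃ \ Q ∪ m ∈ B))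

/-- `teeRep` as a weighted sum over pairs. [this work] -/
theorem teeRep_eq_sum (m₂ m₃ : Set ι) :
    teeRep τ Q A B m₂ m₃ = ∑ q : Set ι × Set ι, repInd τ Q q * indZ (tr₂ τ Q q ∪ m₂ ∈ A ∧ tr₃ τ Q q ∪ m₃ ∈ B) := by
  unfold teeRep tr₂ tr₃; rw [triT_rep_eq_sum]

/-- `deeRep` as a weighted sum over pairs. [this work] -/
theorem deeRep_eq_sum (m : Set ι) :
    deeRep τ Q A B m = ∑ q : Set ι × Set ι, repInd τ Q q * indZ (tr₃ τ Q q ∪ m ∈ A ∧ tr₃ τ Q q ∪ m ∈ B) := by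
  unfold deeRep tr₃; rw [triT_rep_eq_sum τ Q (fun _ x₃ => x₃ \ Q ∪ m ∈ A ∧ x₃ \ Q ∪ m ∈ B)]

/-- `teeRep a a` is a twisted `tee`-count and `deeRep a` a twisted `dee`-count: the KLEITMAN STEP `teeRep a a ≤ deeRep a`. [this work] -/
theorem teeRep_le_deeRep {A B : Set (Set ι)} (hA : IsUpperSet A) (hB : IsUpperSet B) (a : Set ι) :
    teeRep τ Q A B a a ≤ deeRep τ Q A B a := by
  have h := teeT_le_deeT τ (repU τ Q) (isUpperSet_shiftQ Q hA a) (isUpperSet_shiftQ Q hB a)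
  have e1 : teeT τ (repU τ Q) (shiftQ Q A a) (shiftQ Q B a) = triT τ (fun x₁ x₂ x₃ => x₁ ∩ Q = Q \ τ ∧ (x₂ \ Q ∪ a ∈ A ∧ x₃ \ Q ∪ a ∈ B)) := by
    unfold teeT; exact triT_congr fun x₁ x₂ x₃ => by simp only [repU, shiftQ, Set.mem_setOf_eq]
  have e2 : deeT τ (repU τ Q) (shiftQ Q A a ∩ shiftQ Q B a) = triT τ (fun x₁ _ x₃ => x₁ ∩ Q = Q \ τ ∧ (x₃ \ Q ∪ a ∈ A ∧ x₃ \ Q ∪ a ∈ B)) := by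
    unfold deeT; exact triT_congr fun x₁ x₂ x₃ => by simp only [repU, shiftQ, Set.mem_setOf_eq, Set.mem_inter_iff]
  unfold teeRep deeRep
  rw [← e1, ← e2]; exact_mod_cast h

/-- Exchange: a pattern double sum of weighted pair-sums is a pair-sum of pattern double sums. [this work] -/
theorem patSum_mul_sum (w : Set ι → Set ι → ℤ) (g : Set ι × Set ι → Set ι → Set ι → ℤ) :
    patSum Q (fun u a => w u a * ∑ q : Set ι × Set ι, repInd τ Q q * g q u a) =
      ∑ q : Set ι × Set ι, repInd τ Q q * patSum Q (fun u a => w u a * g q u a) := by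
  unfold patSum
  have h1 : ∀ u ∈ subsetsOf Q, ∑ a ∈ subsetsOf (Q \ u), w u a * ∑ q : Set ι × Set ι, repInd τ Q q * g q u a =
      ∑ q : Set ι × Set ι, ∑ a ∈ subsetsOf (Q \ u), repInd τ Q q * (w u a * g q u a) := by
    intro u _
    rw [sum_comm]
    refine sum_congr rfl fun a _ => ?_
    rw [mul_sum]
    exact sum_congr rfl fun q _ => by ring
  rw [sum_congr rfl h1, sum_comm]
  refine sum_congr rfl fun q _ => ?_
  rw [mul_sum]
  exact sum_congr rfl fun u _ => by rw [mul_sum]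

/-- Exchange for the diagonal sums: `Σ_a w(a)·Σ_q ρ(q)g(q,a) = Σ_q ρ(q)·Σ_a w(a)g(q,a)`. [this work] -/
theorem sum_subsetsOf_mul_sum (w : Set ι → ℤ) (g : Set ι × Set ι → Set ι → ℤ) :
    ∑ a ∈ subsetsOf Q, w a * ∑ q : Set ι × Set ι, repInd τ Q q * g q a =
      ∑ q : Set ι × Set ι, repInd τ Q q * ∑ a ∈ subsetsOf Q, w a * g q a := by
  have h1 : ∀ a ∈ subsetsOf Q, w a * ∑ q : Set ι × Set ι, repInd τ Q q * g q a =
      ∑ q : Set ι × Set ι, repInd τ Q q * (w a * g q a) := by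
    intro a _; rw [mul_sum]; exact sum_congr rfl fun q _ => by ring
  rw [sum_congr rfl h1, sum_comm]
  exact sum_congr rfl fun q _ => by rw [mul_sum]

/-- For a pattern `P`, `(Q \ P₁) \ P₃ = P₂`. [this work] -/
theorem sdiff_sdiff_pt₃ {Q : Set ι} {P : Set ι × Set ι} (hP : P ∈ cfgsIn Q) : (Q \ P.1) \ pt₃ Q P = P.2 := by
  rw [mem_cfgsIn] at hP
  obtain ⟨_, h2, hd⟩ := hP
  unfold pt₃
  ext c; simp only [Set.mem_sdiff, Set.mem_union]
  constructor
  · rintro ⟨⟨hQ, hu⟩, hn⟩; by_contra hc; exact hn ⟨hQ, fun h => h.elim hu hc⟩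
  · intro hc; exact ⟨⟨h2 hc, fun hu => Set.disjoint_left.1 hd hu hc⟩, fun h => h.2 (Or.inr hc)⟩

/-- **Kleitman on `Qᶜ` and (b) pointwise**: `Σ_a [a≠∅]μ(a)·teeRep a a ≤ Σ_a wdiag(a)·deeRep a` (any twist). [this work] -/
theorem sum_mu_teeRep_le {A B : Set (Set ι)} (hA : IsUpperSet A) (hB : IsUpperSet B) :
    ∑ a ∈ subsetsOf Q, (indZ a.Nonempty * mu Q a) * teeRep τ Q A B a a ≤ ∑ a ∈ subsetsOf Q, wdiag Q a * deeRep τ Q A B a := by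
  -- Kleitman termwise
  have hcoef : ∀ a : Set ι, 0 ≤ indZ a.Nonempty * mu Q a := by
    intro a; by_cases ha : a.Nonempty
    · rw [indZ_of_pos ha, one_mul]; exact mu_nonneg Q ha
    · rw [indZ_of_neg ha, zero_mul]
  have h1 : ∑ a ∈ subsetsOf Q, (indZ a.Nonempty * mu Q a) * teeRep τ Q A B a a
      ≤ ∑ a ∈ subsetsOf Q, (indZ a.Nonempty * mu Q a) * deeRep τ Q A B a :=
    sum_le_sum fun a _ => mul_le_mul_of_nonneg_left (teeRep_le_deeRep τ Q hA hB a) (hcoef a)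
  refine h1.trans ?_
  -- both sides as pair-sums of signature functionals of the trace of copy 3
  have hAB : IsUpperSet (A ∩ B) := hA.inter hB
  have e1 : ∑ a ∈ subsetsOf Q, (indZ a.Nonempty * mu Q a) * deeRep τ Q A B a =
      ∑ q : Set ι × Set ι, repInd τ Q q * kStar Q {m : Set ι | tr₃ τ Q q ∪ m ∈ A ∩ B} {m : Set ι | tr₃ τ Q q ∪ m ∈ A ∩ B} := by
    have e : ∀ a ∈ subsetsOf Q, (indZ a.Nonempty * mu Q a) * deeRep τ Q A B a =
        (indZ a.Nonempty * mu Q a) * ∑ q : Set ι × Set ι, repInd τ Q q * indZ (tr₃ τ Q q ∪ a ∈ A ∧ tr₃ τ Q q ∪ a ∈ B) := by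
      intro a _; rw [deeRep_eq_sum]
    rw [sum_congr rfl e, sum_subsetsOf_mul_sum]
    refine sum_congr rfl fun q _ => ?_
    unfold kStar
    congr 1
    refine sum_congr rfl fun a _ => ?_
    have ei : indZ (a.Nonempty ∧ a ∈ {m : Set ι | tr₃ τ Q q ∪ m ∈ A ∩ B} ∧ a ∈ {m : Set ι | tr₃ τ Q q ∪ m ∈ A ∩ B})
        = indZ a.Nonempty * indZ (tr₃ τ Q q ∪ a ∈ A ∧ tr₃ τ Q q ∪ a ∈ B) := by
      rw [← indZ_and]; exact indZ_congr ⟨fun h => ⟨h.1, h.2.1⟩, fun h => ⟨h.1, h.2, h.2⟩⟩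
    rw [ei]; ring
  have e2 : ∑ a ∈ subsetsOf Q, wdiag Q a * deeRep τ Q A B a =
      ∑ q : Set ι × Set ι, repInd τ Q q * phiPat Q {m : Set ι | tr₃ τ Q q ∪ m ∈ A ∩ B} := by
    have e : ∀ a ∈ subsetsOf Q, wdiag Q a * deeRep τ Q A B a =
        wdiag Q a * ∑ q : Set ι × Set ι, repInd τ Q q * indZ (tr₃ τ Q q ∪ a ∈ A ∧ tr₃ τ Q q ∪ a ∈ B) := by
      intro a _; rw [deeRep_eq_sum]
    rw [sum_congr rfl e, sum_subsetsOf_mul_sum]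
    refine sum_congr rfl fun q _ => ?_
    unfold phiPat
    congr 1
    refine sum_congr rfl fun a _ => ?_
    have ei : indZ (a ∈ {m : Set ι | tr₃ τ Q q ∪ m ∈ A ∩ B}) = indZ (tr₃ τ Q q ∪ a ∈ A ∧ tr₃ τ Q q ∪ a ∈ B) := rfl
    rw [ei]; ring
  rw [e1, e2]
  exact sum_le_sum fun q _ => mul_le_mul_of_nonneg_left (kStar_le_phiPat Q (isUpperSet_sig hAB _)) (repInd_nonneg τ Q q)

variable {τ Q} (hτ : τ ∩ Q = ∅)
include hτ

/-- **Step 2a**: `R = Σ_q ρ(q)·W(𝔄_q, 𝔅_q)` with the signatures `𝔄_q = {m : tr₂ q ∪ m ∈ A}`, `𝔅_q = {m : tr₃ q ∪ m ∈ B}` (untwisted `Q`). [this work] -/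
theorem rPart_eq_sum_wPat :
    rPart τ (orFam Q) A B = ∑ q : Set ι × Set ι, repInd τ Q q *
      wPat Q {m : Set ι | tr₂ τ Q q ∪ m ∈ A} {m : Set ι | tr₃ τ Q q ∪ m ∈ B} := by
  rw [rPart_eq_sum_cPat]
  -- rewrite each summand through (P₁, P₃) only
  have e : ∀ P ∈ cfgsIn Q, cPat τ Q P * teeRep τ Q A B (qc₂ τ Q P) (qc₃ τ Q P) =
      wcoef Q P.1 (pt₃ Q P) * teeRep τ Q A B ((Q \ P.1) \ pt₃ Q P) (pt₃ Q P) := by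
    intro P hP; unfold cPat wcoef; rw [qc₁_eq hτ, qc₂_eq hτ, qc₃_eq hτ, sdiff_sdiff_pt₃ hP]
  rw [sum_congr rfl e, sum_cfgsIn_eq_patSum Q (fun P => wcoef Q P.1 (pt₃ Q P) * teeRep τ Q A B ((Q \ P.1) \ pt₃ Q P) (pt₃ Q P))]
  unfold wPat
  rw [← patSum_mul_sum]
  unfold patSum
  refine sum_congr rfl fun u _ => sum_congr rfl fun a ha => ?_
  rw [mem_subsetsOf] at ha
  dsimp only
  rw [pt₃_mk ha, teeRep_eq_sum]
  congr 1
  refine sum_congr rfl fun q _ => ?_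
  rw [indZ_and]; rfl

/-- **Step 2b**: `(♥)` pointwise and the exchange to the diagonal: `R ≤ Σ_{a} [a≠∅]·μ(a)·teeRep a a`. [this work] -/
theorem rPart_le_sum_mu_teeRep {A B : Set (Set ι)} (hA : IsUpperSet A) (hB : IsUpperSet B) :
    rPart τ (orFam Q) A B ≤ ∑ a ∈ subsetsOf Q, (indZ a.Nonempty * mu Q a) * teeRep τ Q A B a a := by
  rw [rPart_eq_sum_wPat A B hτ]
  have h1 : ∑ q : Set ι × Set ι, repInd τ Q q * wPat Q {m : Set ι | tr₂ τ Q q ∪ m ∈ A} {m : Set ι | tr₃ τ Q q ∪ m ∈ B}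
      ≤ ∑ q : Set ι × Set ι, repInd τ Q q * kStar Q {m : Set ι | tr₂ τ Q q ∪ m ∈ A} {m : Set ι | tr₃ τ Q q ∪ m ∈ B} :=
    sum_le_sum fun q _ => mul_le_mul_of_nonneg_left (wPat_le_kStar Q (isUpperSet_sig hA _) (isUpperSet_sig hB _)) (repInd_nonneg τ Q q)
  refine h1.trans (le_of_eq ?_)
  have e : ∀ a ∈ subsetsOf Q, (indZ a.Nonempty * mu Q a) * teeRep τ Q A B a a =
      (indZ a.Nonempty * mu Q a) * ∑ q : Set ι × Set ι, repInd τ Q q * indZ (tr₂ τ Q q ∪ a ∈ A ∧ tr₃ τ Q q ∪ a ∈ B) := by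
    intro a _; rw [teeRep_eq_sum]
  rw [sum_congr rfl e, sum_subsetsOf_mul_sum]
  refine sum_congr rfl fun q _ => ?_
  unfold kStar
  congr 1
  refine sum_congr rfl fun a _ => ?_
  have ei : indZ (a.Nonempty ∧ a ∈ {m : Set ι | tr₂ τ Q q ∪ m ∈ A} ∧ a ∈ {m : Set ι | tr₃ τ Q q ∪ m ∈ B})
      = indZ a.Nonempty * indZ (tr₂ τ Q q ∪ a ∈ A ∧ tr₃ τ Q q ∪ a ∈ B) := by rw [← indZ_and]; rfl
  rw [ei]; ring

/-- **Step 2d**: the one-copy part is `Φ = Σ_a wdiag(a)·deeRep a` (untwisted `Q`). [this work] -/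
theorem phiPart_eq_sum_wdiag : phiPart τ (orFam Q) A B = ∑ a ∈ subsetsOf Q, wdiag Q a * deeRep τ Q A B a := by
  unfold phiPart
  rw [triT_eq_sum_cfgsIn τ Q (fun _ _ x₃ => x₃ ∈ orFam Q ∧ x₃ ∈ A ∧ x₃ ∈ B),
    triT_eq_sum_cfgsIn τ Q (fun x₁ _ x₃ => x₁ ∈ orFam Q ∧ x₃ ∈ A ∧ x₃ ∈ B)]
  push_cast
  rw [mul_sum, ← sum_sub_distrib]
  have e : ∀ P ∈ cfgsIn Q,
      (2 * (triT τ (fun x₁ x₂ x₃ => x₁ ∩ Q = Q \ τ ∧ (x₃ \ Q ∪ qc₃ τ Q P ∈ orFam Q ∧ x₃ \ Q ∪ qc₃ τ Q P ∈ A ∧ x₃ \ Q ∪ qc₃ τ Q P ∈ B)) : ℤ)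
        - (triT τ (fun x₁ x₂ x₃ => x₁ ∩ Q = Q \ τ ∧ (x₁ \ Q ∪ qc₁ τ Q P ∈ orFam Q ∧ x₃ \ Q ∪ qc₃ τ Q P ∈ A ∧ x₃ \ Q ∪ qc₃ τ Q P ∈ B)) : ℤ))
      = (2 * indZ (pt₃ Q P).Nonempty - indZ P.1.Nonempty) * deeRep τ Q A B (pt₃ Q P) := by
    intro P hP
    rw [mem_cfgsIn] at hP
    have f3 : (triT τ (fun x₁ x₂ x₃ => x₁ ∩ Q = Q \ τ ∧ (x₃ \ Q ∪ qc₃ τ Q P ∈ orFam Q ∧ x₃ \ Q ∪ qc₃ τ Q P ∈ A ∧ x₃ \ Q ∪ qc₃ τ Q P ∈ B)) : ℤ)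
        = indZ (qc₃ τ Q P).Nonempty * deeRep τ Q A B (qc₃ τ Q P) := by
      unfold deeRep; rw [← triT_and_const]; exact_mod_cast triT_congr fun a b d => by
        rw [sdiff_union_mem_orFam_iff (x := d) (qc₃_subset τ Q P)]; tauto
    have f1 : (triT τ (fun x₁ x₂ x₃ => x₁ ∩ Q = Q \ τ ∧ (x₁ \ Q ∪ qc₁ τ Q P ∈ orFam Q ∧ x₃ \ Q ∪ qc₃ τ Q P ∈ A ∧ x₃ \ Q ∪ qc₃ τ Q P ∈ B)) : ℤ)
        = indZ (qc₁ τ Q P).Nonempty * deeRep τ Q A B (qc₃ τ Q P) := by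
      unfold deeRep; rw [← triT_and_const]; exact_mod_cast triT_congr fun a b d => by
        rw [sdiff_union_mem_orFam_iff (x := a) (qc₁_subset (τ := τ) hP.1)]; tauto
    rw [f3, f1, qc₁_eq hτ, qc₃_eq hτ]; ring
  rw [sum_congr rfl e, sum_cfgsIn_eq_patSum Q (fun P => (2 * indZ (pt₃ Q P).Nonempty - indZ P.1.Nonempty) * deeRep τ Q A B (pt₃ Q P)),
    patSum_comm]
  unfold patSum wdiag
  refine sum_congr rfl fun a ha => ?_
  rw [mem_subsetsOf] at ha
  rw [sum_mul]
  refine sum_congr rfl fun u hu => ?_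
  rw [mem_subsetsOf] at hu
  have ha' : a ⊆ Q \ u := fun c hc => ⟨ha hc, fun hcu => (hu hcu).2 hc⟩
  dsimp only
  rw [pt₃_mk ha']

/-- **THE ONE-DISJUNCTION THEOREM, untwisted-`Q` case**: for every twist `τ` with `τ ∩ Q = ∅` and all up-sets `A, B`,
`threePartNT τ (orFam Q) A B ≥ 0`. [this work] -/
theorem threePartNT_orFam_nonneg_of_disjoint {A B : Set (Set ι)} (hA : IsUpperSet A) (hB : IsUpperSet B) :
    0 ≤ threePartNT τ (orFam Q) A B := by
  rw [threePartNT_eq_phiPart_sub_rPart, phiPart_eq_sum_wdiag A B hτ, sub_nonneg]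
  exact (rPart_le_sum_mu_teeRep hτ hA hB).trans (sum_mu_teeRep_le τ Q hA hB)

end ChainII

end Summit.CriticalPhenomena.PercolationContinuityZ3.Theorems.ThreePartition

end
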